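import Literature.NumberTheory.Rogawski1990.ArchSingularOrbitalIntegralProductPlaces   -- ★ p841332 (R1-c): `archPiEquivCM_symm_circleDiagonal_eq_archDiagTorus`, `apply_mem_centralizer_iff_mem_pi_centralizer`; brings `subgroupPiCoords`
import Literature.NumberTheory.Automorphic.UnitaryGroupOrbitalMeasureOfLocalQuotient      -- ★ `isHaarMeasure_map_subgroupCongrHomeomorph`, `isInvInvariant_map_subgroupCongrHomeomorph` (already in ★ (R1-c)'s closure)
import HarnessLib

/-!
# The product centraliser measure at a torus point of `U(diag α)(L⁺ ⊗ ℝ) ≅ Π_w U(σ_w diag α)`: from per-place centraliser Haar data to the telescope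
# `(ρP, ρ′)` of ★ (R1-c) ∕ ★ (D5) («(E4b)∕(W2) PRODUCT∕TRANSPORT CONSTRUCTION»; Rogawski (1990) §1.7 p. 6, §8.2 pp. 122–124, §14.5 p. 238; Folland (1995) (2.52))

Topic `NumberTheory/Rogawski1990`; namespace `Literature.NumberTheory.Automorphic.UnitaryGroup` (as ★ (R1-c)).  THEOREMS ONLY (no definition, no instance, no notation, no named fact,
no `sorry`).  Cell `pub/hodgecm-mathlib`, crux H413 (`stmt-HodgeConjecture-24833`); (ST-∞) dress of the (R1-h)∕(R1-i) chain of F0P3a-p07 (g8) (CENSUS-R1i-END e599836f, residual (E4b));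
F0P3-p03 (g10) census `CENSUS-E4b-SingularPinsBuilt` 1291225b, brick (W2).  Author F0P3-p03 (g10), 2026-09-01.  Count-neutral plumbing; HONEST LABEL: HC_CM is proved only modulo the printed
citations until rung 0 closes.

WHAT.  ★ (R1-c) p841332 and its consumers ★ p841776 ∕ ★ p842366 (D5) ∕ ★ p842470 take, at every torus point `t(z) = e⁻¹((diag z_w)_w)` of the archimedean group `U(diag α)(L⁺ ⊗ ℝ)`
(`e = archPiEquivCM`), the centraliser measure in TELESCOPE form: a Haar, inversion-invariant `ρP` on `Π_w Z_w(diag z_w) ≤ Π_w G_w` whose coordinates are a PRODUCT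
(`hρP : (subgroupPiCoords)_* ρP = ⊗_w ρZ_w`) and its transport `ρ′` to `Z(t(z)) ≤ U(diag α)(L⁺ ⊗ ℝ)` along `e⁻¹` (`hρ′`).  This file CONSTRUCTS the telescope from the per-place data:
**`exists_pi_centralizer_measures`** — for Haar, inversion-invariant `ρZ_w` on the `Z_w(diag z_w)` there are `ρP`, `ρ′` with ★ (D5)'s binders `hρPi ∧ hρP ∧ hρ′i ∧ hρ′` VERBATIM
(`ρP := (⊗_w ρZ_w)` pulled back along `subgroupPiCoords` (a homeomorphism: ★ `subgroupPiHomeomorph`), `ρ′ := ` its transport; Mathlib `Measure.pi.isHaarMeasure` ∕ `pi.isInvInvariant`,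
`MulEquiv.isHaarMeasure_map`, ★ `isInvInvariant_map_mulEquiv`, ★ `isHaarMeasure_map_subgroupCongrHomeomorph` ∕ `isInvInvariant_…`).  The (ST-∞)
witness (census (W1)–(W4)) instantiates it at `z := z⁰ ∘ ρ` for every relabelling tuple `ρ`, so that ★ p842470's singular-measure inputs shrink to the per-place `ρZ_w(σ)`, `hq` and `hM`.

## References
* [Rogawski1990] J. D. Rogawski, *Automorphic Representations of Unitary Groups in Three Variables*, Ann. of Math. Stud. 123 (1990), §1.7 p. 6 (product measures), §8.2 pp. 122–124,
  §14.5 p. 238.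
* [Folland1995] G. B. Folland, *A Course in Abstract Harmonic Analysis* (1995), §2.6 (2.52).
* [DeitmarEchterhoff2014] A. Deitmar, S. Echterhoff, *Principles of Harmonic Analysis*, 2nd ed. (2014), Thm. 1.5.3.
-/

set_option autoImplicit false

noncomputable section

open MeasureTheory Measure Set NumberField NumberField.InfinitePlace Matrix
open Literature.MeasureTheory.Group Literature.NumberTheory.Automorphic
open scoped ENNReal NNReal Classical

namespace Literature.NumberTheory.Automorphic.UnitaryGroup

variable (L : Type) [Field L] [NumberField L] [IsCMField L] (N : ℕ) (α : Fin N → L)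
  [MeasurableSpace (arch (↥(maximalRealSubfield L)) L (IsCMField.complexConj L) N (Matrix.diagonal α))]
  [BorelSpace (arch (↥(maximalRealSubfield L)) L (IsCMField.complexConj L) N (Matrix.diagonal α))]
  [∀ w : {w : InfinitePlace L // IsComplex w}, MeasurableSpace (archLocal L N (Matrix.diagonal α) w)]
  [∀ w : {w : InfinitePlace L // IsComplex w}, BorelSpace (archLocal L N (Matrix.diagonal α) w)]
  [iSC : ∀ w : {w : InfinitePlace L // IsComplex w}, SecondCountableTopology (archLocal L N (Matrix.diagonal α) w)]
  [iLC : ∀ w : {w : InfinitePlace L // IsComplex w}, LocallyCompactSpace (archLocal L N (Matrix.diagonal α) w)]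

/-- **(W2) THE PRODUCT∕TRANSPORT CONSTRUCTION OF THE CENTRALISER TELESCOPE AT A TORUS POINT.**  Given, at every complex place `w`, a Haar inversion-invariant measure `ρZ_w`
on the centraliser `Z_w(diag z_w) ≤ G_w = U(σ_w diag α)`, there are a Haar inversion-invariant `ρP` on `Π_w Z_w(diag z_w) ≤ Π_w G_w` with `(subgroupPiCoords)_* ρP = ⊗_w ρZ_w` and
its transport `ρ′ = (e⁻¹|_{Π Z_w})_* ρP` on `Z(t(z)) ≤ U(diag α)(L⁺ ⊗ ℝ)`, Haar and inversion-invariant — the binders `hρPi`, `hρP`, `hρ′i`, `hρ′` of ★ (D5)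
`prod_mul_archStableOrbitalIntegral_kottwitzSign_eq_of_regular_eq_of_clause` ∕ ★ (R1-c) VERBATIM (at `z := z⁰ ∘ ρ`).  (The `∀ w` instance binders `iSC`, `iLC` are Props: pass
`fun w => secondCountableTopology_archLocal …` ∕ `locallyCompactSpace_archLocal …`.)
[cite: Rogawski1990, §1.7 p. 6; §8.2 pp. 122–124] [cite: Folland1995, §2.6 (2.52)] [cite: DeitmarEchterhoff2014, Thm. 1.5.3] -/
theorem exists_pi_centralizer_measures (z : {w : InfinitePlace L // IsComplex w} → Fin N → Circle)
    (ρZ : ∀ w : {w : InfinitePlace L // IsComplex w}, Measure (Subgroup.centralizer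
      ({(⟨circleDiagonal N (z w), circleDiagonal_mem_archLocal_diagonal L N α w (z w)⟩ : archLocal L N (Matrix.diagonal α) w)} : Set (archLocal L N (Matrix.diagonal α) w))))
    (hρZi : ∀ w, (ρZ w).IsHaarMeasure ∧ (ρZ w).IsInvInvariant) :
    ∃ (ρP : Measure (Subgroup.pi Set.univ (fun w : {w : InfinitePlace L // IsComplex w} => Subgroup.centralizer
        ({(⟨circleDiagonal N (z w), circleDiagonal_mem_archLocal_diagonal L N α w (z w)⟩ : archLocal L N (Matrix.diagonal α) w)} : Set _))))
      (ρ' : Measure (Subgroup.centralizer ({archDiagTorus L N α z} : Set (arch (↥(maximalRealSubfield L)) L (IsCMField.complexConj L) N (Matrix.diagonal α))))),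
      (ρP.IsHaarMeasure ∧ ρP.IsInvInvariant) ∧
      Measure.map (subgroupPiCoords fun w : {w : InfinitePlace L // IsComplex w} => Subgroup.centralizer
        ({(⟨circleDiagonal N (z w), circleDiagonal_mem_archLocal_diagonal L N α w (z w)⟩ : archLocal L N (Matrix.diagonal α) w)} : Set _)) ρP = Measure.pi ρZ ∧
      (ρ'.IsHaarMeasure ∧ ρ'.IsInvInvariant) ∧
      ρ' = ρP.map (subgroupCongrHomeomorph (archPiEquivCM N L (Matrix.diagonal α)).symm.toMulEquiv
        (Subgroup.pi Set.univ (fun w : {w : InfinitePlace L // IsComplex w} => Subgroup.centralizer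
          ({(⟨circleDiagonal N (z w), circleDiagonal_mem_archLocal_diagonal L N α w (z w)⟩ : archLocal L N (Matrix.diagonal α) w)} : Set _)))
        (Subgroup.centralizer ({archDiagTorus L N α z} : Set _))
        (apply_mem_centralizer_iff_mem_pi_centralizer _ (archPiEquivCM N L (Matrix.diagonal α)).symm.toMulEquiv
          (archPiEquivCM_symm_circleDiagonal_eq_archDiagTorus L N α z))
        (archPiEquivCM N L (Matrix.diagonal α)).symm.continuous (archPiEquivCM N L (Matrix.diagonal α)).continuous) := by
  -- the factors
  haveI hZh : ∀ w, (ρZ w).IsHaarMeasure := fun w => (hρZi w).1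
  haveI hZi : ∀ w, (ρZ w).IsInvInvariant := fun w => (hρZi w).2
  haveI hLC : ∀ w : {w : InfinitePlace L // IsComplex w}, LocallyCompactSpace (Subgroup.centralizer
      ({(⟨circleDiagonal N (z w), circleDiagonal_mem_archLocal_diagonal L N α w (z w)⟩ : archLocal L N (Matrix.diagonal α) w)} : Set (archLocal L N (Matrix.diagonal α) w))) :=
    fun w => (isClosed_coe_centralizer_singleton _).isClosedEmbedding_subtypeVal.locallyCompactSpace
  haveI hSC : ∀ w : {w : InfinitePlace L // IsComplex w}, SecondCountableTopology (Subgroup.centralizer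
      ({(⟨circleDiagonal N (z w), circleDiagonal_mem_archLocal_diagonal L N α w (z w)⟩ : archLocal L N (Matrix.diagonal α) w)} : Set (archLocal L N (Matrix.diagonal α) w))) :=
    fun w => TopologicalSpace.Subtype.secondCountableTopology _
  -- the product, pulled back to the subgroup `Π_w Z_w` along the coordinates `subgroupPiCoords` (a homeomorphism)
  set e := subgroupPiCoords (fun w : {w : InfinitePlace L // IsComplex w} => Subgroup.centralizer
      ({(⟨circleDiagonal N (z w), circleDiagonal_mem_archLocal_diagonal L N α w (z w)⟩ : archLocal L N (Matrix.diagonal α) w)} : Set (archLocal L N (Matrix.diagonal α) w)))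
    with he
  have hec : Continuous (⇑e) := (subgroupPiHomeomorph fun w : {w : InfinitePlace L // IsComplex w} => Subgroup.centralizer
      ({(⟨circleDiagonal N (z w), circleDiagonal_mem_archLocal_diagonal L N α w (z w)⟩ : archLocal L N (Matrix.diagonal α) w)} : Set (archLocal L N (Matrix.diagonal α) w))).continuous
  have hesc : Continuous (⇑e.symm) := (subgroupPiHomeomorph fun w : {w : InfinitePlace L // IsComplex w} => Subgroup.centralizer
      ({(⟨circleDiagonal N (z w), circleDiagonal_mem_archLocal_diagonal L N α w (z w)⟩ : archLocal L N (Matrix.diagonal α) w)} : Set (archLocal L N (Matrix.diagonal α) w))).symm.continuous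
  haveI : LocallyCompactSpace (Subgroup.pi Set.univ (fun w : {w : InfinitePlace L // IsComplex w} => Subgroup.centralizer
      ({(⟨circleDiagonal N (z w), circleDiagonal_mem_archLocal_diagonal L N α w (z w)⟩ : archLocal L N (Matrix.diagonal α) w)} : Set (archLocal L N (Matrix.diagonal α) w)))) :=
    (isClosed_coe_pi_centralizer fun w => (⟨circleDiagonal N (z w), circleDiagonal_mem_archLocal_diagonal L N α w (z w)⟩ :
      archLocal L N (Matrix.diagonal α) w)).isClosedEmbedding_subtypeVal.locallyCompactSpace
  have hPh : ((Measure.pi ρZ).map e.symm).IsHaarMeasure := MulEquiv.isHaarMeasure_map (Measure.pi ρZ) e.symm hesc hec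
  have hPi : ((Measure.pi ρZ).map e.symm).IsInvInvariant := isInvInvariant_map_mulEquiv e.symm hesc.measurable _
  have hP : Measure.map e ((Measure.pi ρZ).map e.symm) = Measure.pi ρZ := by
    rw [Measure.map_map hec.measurable hesc.measurable, show (⇑e ∘ ⇑e.symm) = id from funext fun x => e.apply_symm_apply x, Measure.map_id]
  -- the transport to `Z(t(z))`
  haveI := hPh
  haveI := hPi
  refine ⟨(Measure.pi ρZ).map e.symm, _, ⟨hPh, hPi⟩, hP, ⟨?_, ?_⟩, rfl⟩
  · exact isHaarMeasure_map_subgroupCongrHomeomorph _ _ _ _ _ _ _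
  · exact isInvInvariant_map_subgroupCongrHomeomorph _ _ _ _ _ _ _

end Literature.NumberTheory.Automorphic.UnitaryGroup

end
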